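import Summits.Schanuel.Schanuel.Theorems.RootDecomp1KLevelFinite03

/-!
# RootDecomp1KLevelFinite — lens 1, generation 51, node 10 «LEVEL FINITENESS: the thin-fibre residual ThinFibre m₀ (ALL P ≠ 0, EVERY m₀ ≥ 2) GRADED BY SIEGEL'S EXCEPTIONAL CLASSES» — continuation (RootDecomp1KLevelFinite04): §6 headline corollaries + §7 the non-split conjugate-poles grade (proved)

(lens-1 g51 HOME kernel K = HOME/decomp-schanuel-lens-1/g51/LevelFinite.lean b1fbaeff…, 843 l, ONE import …RootDecomp1KXLinear05 BY NAME; P LevelFiniteProbe.lean 6077dbab… rc 0 / C₀ LevelFiniteCtrl0.lean 388c6d35… rc 0 / C LevelFiniteCtrl.lean 6b696b71… rc 1 = 16 planted; memo NODE-g51.md ed9ba755…; CLAIM L2477, EX-ANTE PRICE + CHECKLIST K-g51 L2478, NODE L2479 / REQUEST L2480, writer re-check L2481, critic VERDICT L2482: CLEARED AS PRICED EX ANTE — ONE THEOREM ×1 «LEVEL-FINITENESS REDUCTION», RULE K-R40, PORT GO. Port by census-1 gen 21 as `RootDecomp1KLevelFinite01–04` along K's §0–§7: 01 = §0 the truncations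 `sQ` + §1 `LevelFinite` (def) and the PROVED glue `thinFibre_of_levelFinite` / (b); 02 = §2 the Siegel–Mahler trichotomy typed to consumption shape (`IsDyadic`, `NormShapeHyp`, `SiegelShapes` [requested Literature fact, cite item wi-102309], `LaurentShapeLF`, `TwoAdicBounded`, `NormShapeLFNonsplit`, `NormShapeLFSplitImag` [hypothesis, ATTACKABLE], `NormShapeLFSplitReal` [hypothesis, FACT-NEEDED, cite item wi-102310], `NormShapeLevels`) + §3 the one-pole shape PROVED from the tree's `levels_finite` (Ridout by tree name); 03 = §4 the assembly `levelFinite_of_siegelShapes` / `thinFibre_of_siegelShapes` / `b_of_siegelShapes` + §5 the two-rational-poles shape PROVED hyp-free (`laurentShapeLF_holds`); 04 = §6 headline corollaries + §7 the non-split conjugate-poles grade PROVED (`normShapeLFNonsplit_holds`) and the primed headline corollaries. PORT EDITS (census convention, pre-sanctioned L2482): `isCoprime_num_den` PRIVATISED (verbatim twin of `Literature.NumberTheory.DiophantineApproximation.SparseDyadicRationals.isCoprime_num_den`, writer flag (α)); `padicValInt_two_pow` (v₂(xⁿ) = n·v₂(x)) privatised + documented (generic one-liner; a DIFFERENT statement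 under the same short name is private in CollarCell01 / CollarWall01); docstrings added on `thinFibre_of_siegelShapes'` / `b_of_siegelShapes'`; the two «[cite …]» brackets inside the docstrings of the HYPOTHESIS defs `SiegelShapes` / `NormShapeLFSplitReal` re-punctuated to «(sources: …)» so that the gate does not RELOCATE these consumption-shape hypothesis statements into Literature/Uncategorized (first filing p841087 was relocated and bounced there: an inline-cited `def … : Prop` is treated as a Literature fact; these are NOT verbatim print — cite-kind items wi-102309 / wi-102310 track the facts), text otherwise unchanged; per-part private copies if any; K carries no `set_option` (its 52 dupNamespace lint warnings are HOME-path artefacts, 0 in the tree build); statements and proofs otherwise verbatim, no renames, no heartbeat lines. `--supports stmt-Schanuel-33364`; no census credit carried; rung 0 — nothing here proves Schanuel, 33364, 31077, 33363, ThinFibre m₀ or the (b)-cell hypothesis-free.)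
-/

noncomputable section

open Polynomial LiouvilleNumber
open scoped Nat

namespace Summit.Schanuel.Schanuel.Theorems.RootDecomp1KLevelFinite

open Summit.Schanuel.Schanuel.Theorems.RootDecomp1KSkelCell (iota SkelLiouville SkelLiouvilleFix
  skelLiouville_iff_fix SkelLiouvilleFix.mono)
open Summit.Schanuel.Schanuel.Theorems.RootDecomp1KTwoBaseCell (psNumer partialSum_eq_psNumer_div coprime_psNumer
  sb_of_range_eq')
open Summit.Schanuel.Schanuel.Theorems.RootDecomp1KRelLiouvilleCell (partialSum_two_strictMono)
open Summit.Schanuel.Schanuel.Theorems.RootDecomp1KDegreeLadder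
open Summit.Schanuel.Schanuel.Theorems.RootDecomp1KXLinear (xLinP bev_xLinP aeval_ratCast levels_finite
  thinFibreAt_mul_left)
open Summit.Schanuel.Schanuel.Theorems.RootDecomp1KHyper (SB SFset sb_of_algebraicIndependent)

/-- Numerator and denominator of a rational are coprime integers. -/
private theorem isCoprime_num_den (t : ℚ) : IsCoprime t.num (t.den : ℤ) := by
  rw [Int.isCoprime_iff_gcd_eq_one, Int.gcd_eq_natAbs, Int.natAbs_natCast]
  exact t.reduced

/-! ## §6  HEADLINE COROLLARIES with the two-rational-poles piece DISCHARGED -/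

/-- **LEVEL FINITENESS OF EVERY PRIME CURVE, MODULO `SiegelShapes` AND THE THREE CONJUGATE-POLES GRADES ONLY**
(the one-pole and two-rational-poles pieces are PROVED: `polyShapeLF`, `laurentShapeLF_holds`). -/
theorem levelFinite_of_siegelShapes (hS : SiegelShapes) (h₁ : NormShapeLFNonsplit)
    (h₂ : NormShapeLFSplitImag) (h₃ : NormShapeLFSplitReal) :
    ∀ P : ℤ[X][X], Prime P → 2 ≤ P.natDegree → LevelFinite P :=
  levelFinite_of_shapes hS laurentShapeLF_holds h₁ h₂ h₃

/-- **UNIFORM THIN FIBRES AT EVERY QUALITY `m₀ ≥ 2` (K-R36 (ii)), MODULO `SiegelShapes` + THE THREE GRADES.** -/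
theorem thinFibre_of_siegelShapes (hS : SiegelShapes) (h₁ : NormShapeLFNonsplit)
    (h₂ : NormShapeLFSplitImag) (h₃ : NormShapeLFSplitReal) {m₀ : ℕ} (hm : 2 ≤ m₀) : ThinFibre m₀ :=
  thinFibre_of_shapes hS laurentShapeLF_holds h₁ h₂ h₃ hm

/-- **THE (b)-CELL AT EVERY FIXED QUALITY `m₀ ≥ 2` (K-R36 (iii)), MODULO `SiegelShapes` + THE THREE GRADES.** -/
theorem b_of_siegelShapes (hS : SiegelShapes) (h₁ : NormShapeLFNonsplit) (h₂ : NormShapeLFSplitImag)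
    (h₃ : NormShapeLFSplitReal) {m₀ : ℕ} (hm : 2 ≤ m₀) (ρ : ℝ) (hρ : SkelLiouvilleFix m₀ ρ) :
    AlgebraicIndependent ℚ ![((liouvilleNumber 2 : ℝ) : ℂ), (ρ : ℂ)] :=
  b_of_shapes hS laurentShapeLF_holds h₁ h₂ h₃ hm ρ hρ

/-- **ITEM 31077 ON `(ℓ₂, ρ)`, `ρ ∈ SkelFix m₀`, `m₀ ≥ 2`, MODULO `SiegelShapes` + THE THREE GRADES**
(binders VERBATIM + one cell line). -/
theorem coordLiouvilleSchanuel_pair_of_siegelShapes (hS : SiegelShapes) (h₁ : NormShapeLFNonsplit)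
    (h₂ : NormShapeLFSplitImag) (h₃ : NormShapeLFSplitReal) {m₀ : ℕ} (hm : 2 ≤ m₀) {ρ : ℝ}
    (hρ : SkelLiouvilleFix m₀ ρ) :
    ∀ (n : ℕ) (z : Fin n → ℂ), LinearIndependent ℚ z →
      Set.range z = Set.range ![((liouvilleNumber 2 : ℝ) : ℂ), (ρ : ℂ)] →
      (∃ w ∈ Submodule.span ℚ (Set.range z), Liouville w.re ∨ Liouville w.im) →
      (n : Cardinal) ≤ Algebra.trdeg ℚ
        ↥(IntermediateField.adjoin ℚ (Set.range z ∪ Set.range (Complex.exp ∘ z))) :=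
  coordLiouvilleSchanuel_pair_of_shapes hS laurentShapeLF_holds h₁ h₂ h₃ hm hρ

/-! ## §7 The non-split conjugate-poles grade, PROVED: `normShapeLFNonsplit_holds`

Integer bookkeeping only: with `t = u/v` in lowest terms, `Q(u,v) = q₂u² + q₁uv + q₀v² = v²·q(t)` and
`G(u,v) = Σ_{i ≤ 2a} gᵢ uⁱ v^{2a−i} = v^{2a}·g(t)` (`deg g ≤ 2a`), the level equation `g(t) = D·s_N·q(t)^a` becomes
`2^{N!}·G(u,v) = D·p_N·Q(u,v)^a` in `ℤ` (`p_N = psNumer 2 N`, odd for `N ≥ 2`).  Hence `2^{N!} ∣ D·p_N·Q(u,v)^a ≠ 0`, so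
`N ≤ N! ≤ v₂(D) + a·v₂(Q(u,v)) ≤ v₂(D) + a·B` when `2^B ∤ Q(u,v)` for all coprime `(u,v)` (`TwoAdicBounded q`). -/

/-- `padicValInt 2 (x ^ n) = n * padicValInt 2 x` for `x ≠ 0`. -/
private theorem padicValInt_two_pow (x : ℤ) (hx : x ≠ 0) (n : ℕ) :
    padicValInt 2 (x ^ n) = n * padicValInt 2 x := by
  induction n with
  | zero => simp [padicValInt.one]
  | succ n ih => rw [pow_succ, padicValInt.mul (pow_ne_zero _ hx) hx, ih]; ring

/-- the binary form of a quadratic `q` at `(t.num, t.den)` is `t.den² · q(t)`. -/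
theorem binaryForm_eq {q : ℤ[X]} (hq : q.natDegree = 2) (t : ℚ) :
    ((q.coeff 2 * t.num ^ 2 + q.coeff 1 * t.num * t.den + q.coeff 0 * (t.den : ℤ) ^ 2 : ℤ) : ℚ)
      = (t.den : ℚ) ^ 2 * aeval t q := by
  have hq3 : q.natDegree < 3 := by omega
  rw [aeval_eq_sum_range' hq3]
  simp only [Finset.sum_range_succ, Finset.sum_range_zero, zsmul_eq_mul, pow_zero, mul_one, zero_add]
  push_cast
  rw [← Rat.mul_den_eq_num t]
  ring

/-- the cleared-denominator INTEGER identity of the conjugate-poles level equation. -/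
theorem normLevel_identity {g q : ℤ[X]} {a : ℕ} {D : ℤ} {t : ℚ} {N : ℕ} (hq : q.natDegree = 2)
    (hga : g.natDegree ≤ 2 * a) (h : aeval t g = D * sQ N * (aeval t q) ^ a) :
    (2 : ℤ) ^ N ! * (∑ i ∈ Finset.range (2 * a + 1), g.coeff i * t.num ^ i * (t.den : ℤ) ^ (2 * a - i))
      = D * (psNumer 2 N : ℤ) *
        (q.coeff 2 * t.num ^ 2 + q.coeff 1 * t.num * t.den + q.coeff 0 * (t.den : ℤ) ^ 2) ^ a := by
  have hv0 : (t.den : ℚ) ≠ 0 := by exact_mod_cast t.den_nz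
  have hQ := binaryForm_eq hq t
  set Q : ℤ := q.coeff 2 * t.num ^ 2 + q.coeff 1 * t.num * t.den + q.coeff 0 * (t.den : ℤ) ^ 2 with hQdef
  set G : ℤ := ∑ i ∈ Finset.range (2 * a + 1), g.coeff i * t.num ^ i * (t.den : ℤ) ^ (2 * a - i)
    with hGdef
  -- `G(u,v) = v^{2a} · g(t)` in `ℚ`
  have hG : (G : ℚ) = (t.den : ℚ) ^ (2 * a) * aeval t g := by
    have h2a : g.natDegree < 2 * a + 1 := by omega
    rw [hGdef, aeval_eq_sum_range' h2a, Finset.mul_sum]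
    push_cast
    refine Finset.sum_congr rfl fun i hi => ?_
    have hi' : i ≤ 2 * a := by simpa [Finset.mem_range, Nat.lt_succ_iff] using hi
    have hsplit : (t.den : ℚ) ^ (2 * a) = (t.den : ℚ) ^ i * (t.den : ℚ) ^ (2 * a - i) := by
      rw [← pow_add, Nat.add_sub_cancel' hi']
    rw [zsmul_eq_mul, hsplit, ← Rat.mul_den_eq_num t]
    ring
  have h2 : (2 : ℚ) ^ N ! ≠ 0 := pow_ne_zero _ two_ne_zero
  have key : (((2 : ℤ) ^ N ! * G : ℤ) : ℚ) = ((D * (psNumer 2 N : ℤ) * Q ^ a : ℤ) : ℚ) := by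
    push_cast
    rw [hG, hQ, h, sQ]
    field_simp
    ring
  exact_mod_cast key

/-- **The non-split grade holds** (elementary; no Diophantine approximation): `NormShapeLFNonsplit`. -/
theorem normShapeLFNonsplit_holds : NormShapeLFNonsplit := by
  rintro g q a D ⟨hq2, hqroot, -, ha, hga, hD⟩ ⟨B, hB⟩
  set K : ℕ := padicValInt 2 D + a * B with hK
  refine (Set.finite_Iic (max 1 K)).subset ?_
  rintro N ⟨t, ht⟩
  simp only [Set.mem_Iic]
  by_cases hN : N < 2
  · omega
  push Not at hN
  have hid := normLevel_identity hq2 hga ht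
  set Q : ℤ := q.coeff 2 * t.num ^ 2 + q.coeff 1 * t.num * t.den + q.coeff 0 * (t.den : ℤ) ^ 2 with hQdef
  set G : ℤ := ∑ i ∈ Finset.range (2 * a + 1), g.coeff i * t.num ^ i * (t.den : ℤ) ^ (2 * a - i) with hGdef
  -- `Q ≠ 0`: `q` has no rational root
  have hQ0 : Q ≠ 0 := by
    intro h0
    have hv0 : (t.den : ℚ) ≠ 0 := by exact_mod_cast t.den_nz
    have hQq := binaryForm_eq hq2 t
    rw [← hQdef, h0, Int.cast_zero] at hQq
    exact hqroot t ((mul_eq_zero.mp hQq.symm).resolve_left (pow_ne_zero _ hv0))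
  -- `v₂(Q) < B`
  have hvQ : padicValInt 2 Q < B := by
    by_contra hle
    push Not at hle
    exact hB t.num t.den (isCoprime_num_den t) ((padicValInt_dvd_iff B Q).mpr (Or.inr hle))
  -- `p_N` odd, nonzero
  have hcop : Nat.Coprime (psNumer 2 N) 2 := coprime_psNumer 2 hN
  have hp0 : (psNumer 2 N : ℤ) ≠ 0 := by
    intro h0
    have h0' : psNumer 2 N = 0 := by exact_mod_cast h0
    rw [h0', Nat.coprime_zero_left] at hcop
    omega
  have hpv : padicValInt 2 (psNumer 2 N : ℤ) = 0 := by
    rw [padicValInt.of_nat]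
    refine padicValNat.eq_zero_of_not_dvd fun h2 => ?_
    have := Nat.Coprime.eq_one_of_dvd hcop.symm h2
    omega
  -- `2^{N!} ∣ D · p_N · Q^a ≠ 0`
  have hrhs0 : D * (psNumer 2 N : ℤ) * Q ^ a ≠ 0 :=
    mul_ne_zero (mul_ne_zero hD hp0) (pow_ne_zero _ hQ0)
  have hdvd : (2 : ℤ) ^ N ! ∣ D * (psNumer 2 N : ℤ) * Q ^ a := ⟨G, hid.symm⟩
  have hle : N ! ≤ padicValInt 2 (D * (psNumer 2 N : ℤ) * Q ^ a) :=
    ((padicValInt_dvd_iff _ _).mp (by exact_mod_cast hdvd)).resolve_left hrhs0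
  rw [padicValInt.mul (mul_ne_zero hD hp0) (pow_ne_zero _ hQ0), padicValInt.mul hD hp0, hpv,
    padicValInt_two_pow Q hQ0] at hle
  have haB : a * padicValInt 2 Q ≤ a * B := Nat.mul_le_mul_left a hvQ.le
  have hNf : N ≤ N ! := Nat.self_le_factorial N
  have : N ≤ K := by omega
  exact this.trans (le_max_right 1 K)

/-- COROLLARY of §6 + §7: prime-level finiteness, the uniform thin-fibre residual and the (b)-corollary from
`SiegelShapes` and the two SPLIT conjugate-poles grades only. -/
theorem levelFinite_of_siegelShapes' (hS : SiegelShapes) (h₂ : NormShapeLFSplitImag)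
    (h₃ : NormShapeLFSplitReal) : ∀ P : ℤ[X][X], Prime P → 2 ≤ P.natDegree → LevelFinite P :=
  levelFinite_of_siegelShapes hS normShapeLFNonsplit_holds h₂ h₃

/-- COROLLARY (headline, two-rational-poles and non-split grades DISCHARGED): `SiegelShapes → NormShapeLFSplitImag → NormShapeLFSplitReal → ∀ m₀ ≥ 2, ThinFibre m₀` — the uniform thin-fibre residual of the K-line from Siegel's shapes and the two SPLIT conjugate-poles grades only. -/
theorem thinFibre_of_siegelShapes' (hS : SiegelShapes) (h₂ : NormShapeLFSplitImag)
    (h₃ : NormShapeLFSplitReal) {m₀ : ℕ} (hm : 2 ≤ m₀) : ThinFibre m₀ :=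
  thinFibre_of_siegelShapes hS normShapeLFNonsplit_holds h₂ h₃ hm

/-- COROLLARY (headline): statement (b) of the K-line — `SkelLiouvilleFix m₀ ρ → AlgebraicIndependent ℚ ![ℓ₂, ρ]` for every `m₀ ≥ 2` — from `SiegelShapes` and the two SPLIT conjugate-poles grades only (the other two grades discharged in §5 / §7). -/
theorem b_of_siegelShapes' (hS : SiegelShapes) (h₂ : NormShapeLFSplitImag) (h₃ : NormShapeLFSplitReal)
    {m₀ : ℕ} (hm : 2 ≤ m₀) (ρ : ℝ) (hρ : SkelLiouvilleFix m₀ ρ) :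
    AlgebraicIndependent ℚ ![((liouvilleNumber 2 : ℝ) : ℂ), (ρ : ℂ)] :=
  b_of_siegelShapes hS normShapeLFNonsplit_holds h₂ h₃ hm ρ hρ

end Summit.Schanuel.Schanuel.Theorems.RootDecomp1KLevelFinite

end
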